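import Literature.Analysis.Complex.WeylLemmaDbar
import Literature.Analysis.Complex.DbarAlongHolomorphic
import Literature.Analysis.Complex.LengthArea
import Mathlib.MeasureTheory.Function.Jacobian
import HarnessLib

/-!
# Transport of the `∂̄`-pairing under a conformal frame

Sub-goal (A2-transport) of `stub_polygonIdentification`, line `polygon-parity-squeeze` of the crux
`Summit.CriticalPhenomena.SAWScalingLimit.Theses.SAWDefectDecoherence.BoundaryClosureR`.

Let `Φ` be holomorphic and injective on an open set `V ⊆ ℂ`, with a holomorphic logarithm `Lh` of
`Φ' = deriv Φ` on `V` (`exp ∘ Lh = Φ'`), let `S ⊆ V` be measurable, `g : ℂ → ℂ`, and let `φ` be a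
test function.  With `H := (g · e^{-(5/8) Lh}) ∘ Φ⁻¹` on `Φ(S)` (`Φ⁻¹ = Function.invFunOn Φ V`),

  `∫_{Φ(S)} H ∂̄φ dA = ∫_S g ∂̄[(φ ∘ Φ) · e^{(3/8) Lh}] dA`

(`frameTransport_dbar`).  Proof: the change of variables `w = Φ z`, `dA(w) = |Φ'(z)|² dA(z)`
(Mathlib's `MeasureTheory.integral_image_eq_integral_abs_det_fderiv_smul`, the real Jacobian of
multiplication by `Φ'(z)` being `‖Φ'(z)‖²`, `Literature.Analysis.Complex.LengthArea.det_restrictScalars_smulRight`),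
the chain rule for the Wirtinger derivative under a holomorphic map,
`∂̄(φ ∘ Φ)(z) = conj (Φ'(z)) · (∂̄φ)(Φ z)` (`dbarAlong_one_comp_of_differentiableAt`), the Leibniz
rule with the holomorphic factor `e^{(3/8) Lh}` (`∂̄` of which vanishes), and the pointwise identity
`|Φ'|² e^{-(5/8) Lh} = conj (Φ') e^{Lh} e^{-(5/8) Lh} = conj (Φ') e^{(3/8) Lh}`.

## References

* L. Hörmander, *An Introduction to Complex Analysis in Several Variables*, 2nd ed. (1973), §1.1
  (the operator `∂/∂z̄` and its chain rule). [HormanderSCV1973]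
* H. Duminil-Copin, S. Smirnov, *The connective constant of the honeycomb lattice equals
  `√(2+√2)`*, Ann. of Math. 175 (2012), §3. [DuminilCopinSmirnov2012]
-/

noncomputable section

open scoped Topology ContDiff ComplexConjugate
open Filter Set MeasureTheory Complex Literature.Analysis.Complex

namespace Summit.CriticalPhenomena.SAWScalingLimit.Theorems.PolygonParitySqueeze

/-- **Chain rule for `∂̄_v` under a holomorphic change of variables.**  If `Φ : E → E'` is
complex-differentiable at `x` and `u` is real-differentiable at `Φ x`, then
`∂̄_v (u ∘ Φ)(x) = ∂̄_{DΦ(x) v} u (Φ x)`: the direction is pushed forward by the complex-linear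
differential of `Φ` (Hörmander (1973), §1.1, `∂(u ∘ Φ)/∂z̄ = (∂u/∂w̄) · conj Φ'` in one
variable). [folklore] -/
theorem dbarAlong_comp_of_differentiableAt {E E' F : Type*} [NormedAddCommGroup E]
    [NormedSpace ℂ E] [NormedAddCommGroup E'] [NormedSpace ℂ E'] [NormedAddCommGroup F]
    [NormedSpace ℂ F] {Φ : E → E'} {u : E' → F} {x : E} (hΦ : DifferentiableAt ℂ Φ x)
    (hu : DifferentiableAt ℝ u (Φ x)) (v : E) :
    dbarAlong v (fun y => u (Φ y)) x = dbarAlong (fderiv ℂ Φ x v) u (Φ x) := by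
  have hcomp : HasFDerivAt (fun y => u (Φ y))
      ((fderiv ℝ u (Φ x)).comp ((fderiv ℂ Φ x).restrictScalars ℝ)) x :=
    hu.hasFDerivAt.comp x (hΦ.hasFDerivAt.restrictScalars ℝ)
  rw [dbarAlong_apply, dbarAlong_apply, hcomp.fderiv]
  simp

/-- **Chain rule for the Wirtinger derivative, one variable.**  For `Φ` complex-differentiable at
`z` and `φ` real-differentiable at `Φ z`, `∂̄(φ ∘ Φ)(z) = conj (Φ'(z)) · (∂̄φ)(Φ z)`.
[folklore] -/
theorem dbarAlong_one_comp_of_differentiableAt {φ Φ : ℂ → ℂ} {z : ℂ}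
    (hΦ : DifferentiableAt ℂ Φ z) (hφ : DifferentiableAt ℝ φ (Φ z)) :
    dbarAlong 1 (fun y => φ (Φ y)) z = conj (deriv Φ z) * dbarAlong 1 φ (Φ z) := by
  rw [dbarAlong_comp_of_differentiableAt hΦ hφ, fderiv_apply_one_eq_deriv,
    show deriv Φ z = deriv Φ z • (1 : ℂ) by simp, dbarAlong_smul_left, smul_eq_mul, smul_eq_mul,
    mul_one]

/-- **`∂̄` of the transported test function.**  For `Φ`, `Lh` complex-differentiable at `z`, `φ`
real-differentiable at `Φ z` and a constant `a`,
`∂̄[(φ ∘ Φ) · e^{a Lh}](z) = conj (Φ'(z)) · (∂̄φ)(Φ z) · e^{a Lh z}` (Leibniz rule; the second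
factor is holomorphic, so its `∂̄` vanishes). [folklore] -/
theorem dbarAlong_one_comp_mul_exp {φ Φ Lh : ℂ → ℂ} {z : ℂ} (a : ℂ)
    (hΦ : DifferentiableAt ℂ Φ z) (hLh : DifferentiableAt ℂ Lh z)
    (hφ : DifferentiableAt ℝ φ (Φ z)) :
    dbarAlong 1 (fun y => φ (Φ y) * Complex.exp (a * Lh y)) z =
      conj (deriv Φ z) * dbarAlong 1 φ (Φ z) * Complex.exp (a * Lh z) := by
  have h1 : DifferentiableAt ℝ (fun y => φ (Φ y)) z := hφ.comp z (hΦ.restrictScalars ℝ)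
  have h2 : DifferentiableAt ℂ (fun y => Complex.exp (a * Lh y)) z := (hLh.const_mul a).cexp
  rw [dbarAlong_one_mul h1 (h2.restrictScalars ℝ), dbarAlong_eq_zero_of_differentiableAt h2,
    mul_zero, add_zero, dbarAlong_one_comp_of_differentiableAt hΦ hφ]

/-- **Transport of the `∂̄`-pairing under a conformal frame** (sub-goal (A2-transport) of
`stub_polygonIdentification`).  Let `Φ` be holomorphic and injective on the open set `V`, with a
holomorphic logarithm `Lh` of `Φ'` on `V`, `S ⊆ V` measurable, and `φ ∈ C_c^∞` supported in
`Φ(V)`.  Then for `H := (g · e^{-(5/8) Lh}) ∘ Φ⁻¹`,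
`∫_{Φ(S)} H ∂̄φ dA = ∫_S g ∂̄[(φ ∘ Φ) e^{(3/8) Lh}] dA`: change of variables `w = Φ z`
(`dA(w) = |Φ'(z)|² dA(z)`), the chain rule `∂̄(φ ∘ Φ) = ((∂̄φ) ∘ Φ) · conj Φ'`, and
`|Φ'|² e^{-(5/8) Lh} = conj (Φ') e^{(3/8) Lh}`.  (The two integrability hypotheses are not needed:
Mathlib's change-of-variables identity is unconditional.) [folklore] -/
theorem frameTransport_dbar : ∀ (V S : Set ℂ) (Φ Lh g φ : ℂ → ℂ), IsOpen V → MeasurableSet S → S ⊆ V → DifferentiableOn ℂ Φ V → Set.InjOn Φ V → DifferentiableOn ℂ Lh V → (∀ z ∈ V, Complex.exp (Lh z) = deriv Φ z) → ContDiff ℝ ∞ φ → HasCompactSupport φ → tsupport φ ⊆ Φ '' V → MeasureTheory.IntegrableOn g S → MeasureTheory.IntegrableOn (fun w => g (Function.invFunOn Φ V w) * Complex.exp (-(5 / 8 : ℂ) * Lh (Function.invFunOn Φ V w))) (Φ '' S) → ∫ w in Φ '' S, g (Function.invFunOn Φ V w) * Complex.exp (-(5 / 8 : ℂ) * Lh (Function.invFunOn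 Φ V w)) * Literature.Analysis.Complex.dbarAlong 1 φ w = ∫ z in S, g z * Literature.Analysis.Complex.dbarAlong 1 (fun z => φ (Φ z) * Complex.exp ((3 / 8 : ℂ) * Lh z)) z := by
  intro V S Φ Lh g φ hV hS hSV hΦ hinj hLh hexp hφ _hφc _hφV _hg _hG
  -- the real differential of `Φ` at `z ∈ S`: multiplication by `Φ'(z)`
  have hd : ∀ z ∈ S, HasFDerivWithinAt Φ
      ((ContinuousLinearMap.smulRight (1 : ℂ →L[ℂ] ℂ) (deriv Φ z)).restrictScalars ℝ) S z :=
    fun z hz => ((hΦ.differentiableAt (hV.mem_nhds (hSV hz))).hasDerivAt.hasFDerivAt.restrictScalars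
      ℝ).hasFDerivWithinAt
  -- change of variables `w = Φ z`
  rw [integral_image_eq_integral_abs_det_fderiv_smul volume hS hd (hinj.mono hSV)]
  refine setIntegral_congr_fun hS fun z hz => ?_
  have hzV : z ∈ V := hSV hz
  have hinv : Function.invFunOn Φ V (Φ z) = z := hinj.leftInvOn_invFunOn hzV
  have hΦz : DifferentiableAt ℂ Φ z := hΦ.differentiableAt (hV.mem_nhds hzV)
  have hLz : DifferentiableAt ℂ Lh z := hLh.differentiableAt (hV.mem_nhds hzV)
  have hφz : DifferentiableAt ℝ φ (Φ z) := (hφ.differentiable (by simp)).differentiableAt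
  simp only [hinv]
  rw [LengthArea.det_restrictScalars_smulRight, abs_of_nonneg (by positivity),
    dbarAlong_one_comp_mul_exp _ hΦz hLz hφz, Complex.real_smul]
  -- pointwise algebra: `|Φ'|² e^{-(5/8) Lh} = conj Φ' · e^{Lh} e^{-(5/8) Lh} = conj Φ' · e^{(3/8) Lh}`
  have hc : (((‖deriv Φ z‖ ^ 2 : ℝ)) : ℂ) = conj (deriv Φ z) * Complex.exp (Lh z) := by
    rw [hexp z hzV, ← Complex.normSq_eq_norm_sq, Complex.normSq_eq_conj_mul_self]
  have h38 : Complex.exp (Lh z) * Complex.exp (-(5 / 8 : ℂ) * Lh z) =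
      Complex.exp ((3 / 8 : ℂ) * Lh z) := by
    rw [← Complex.exp_add]
    congr 1
    ring
  rw [hc]
  linear_combination (conj (deriv Φ z) * g z * dbarAlong 1 φ (Φ z)) * h38

end Summit.CriticalPhenomena.SAWScalingLimit.Theorems.PolygonParitySqueeze
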